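import Literature.AlgebraicGeometry.HodgeTheory.FermatDiagonalAction
import Literature.AlgebraicGeometry.HodgeTheory.RationalClassGaloisSupport
import HarnessLib

/-!
# The eigencomponents of a rational class on the Fermat variety: support stable under `(ℤ/m)ˣ`

Family `hodge`, layer `Literature/AlgebraicGeometry/HodgeTheory`. Brick of the middle-degree case of
the named fact `hodgeClasses_algebraic_fermat` (file `FermatHodgeConjecture`): the Fermat
specialisation of `RationalClassGaloisSupport` in the notation of `FermatDiagonalAction` (`μₘⁿ⁺²`
acting on the standard model `X_F`, `F = Σ xᵢᵐ`, characters `χ_α`, `α ∈ (ℤ/m)ⁿ⁺²`, eigenspaces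
`V(α)`). Shioda (Proc. Japan Acad. 55A (1979) §1, Math. Ann. 245 (1979) §1) and Ran (Compositio Math.
42 (1980) Prop. 1.7 (iii)) use that the `ℚ`-structure `Hⁿ(X, ℚ)` forces the Hodge classes to be sums
of whole `(ℤ/m)ˣ`-ORBITS of eigenspaces: "`|tα| = n/2 + 1` for all `t ∈ (ℤ/m)ˣ`" (Shioda's `𝔅ⁿₘ`),
"`s(tχ) = (n/2 + 1)m`, `∀ t ∈ (ℤ/m)ˣ`" (Ran). Everything here is PROVED:

* `fermatCharacter_unitMul`: `χ_{tα} = χ_αᵗ` for `t ∈ (ℤ/m)ˣ` (exponent `t.val`, prime to `m`);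
* `fermatProjector m α k = π_α`, the isotypic projector onto `V(α)` (`eigenProjector` of
  `DiagonalCharacterEigenspace` for `μₘⁿ⁺² ≤ diagonalStabilizer F`), with `fermatProjector_mem`
  (`π_α c ∈ V(α)`) and `sum_fermatProjector` (`Σ_α π_α c = c`);
* **`fermatProjector_eq_zero_iff_unitMul`: for a RATIONAL class `c ∈ Hᵏ(X_F(ℂ); ℂ)` and
  `t ∈ (ℤ/m)ˣ`, `π_α c = 0 ↔ π_{tα} c = 0`** (`eigenProjector_eq_zero_iff_pow` with `s = t.val`,
  prime to `|μₘⁿ⁺²| = mⁿ⁺²`); in particular `π_α c = 0 ↔ π_{-α} c = 0` (complex conjugation).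

## References

* [Shioda1979PJA] T. Shioda, The Hodge conjecture and the Tate conjecture for Fermat varieties,
  Proc. Japan Acad. 55A (1979) 111–114, §1 eq. (2) ("for all `t ∈ (ℤ/m)ˣ`"), §4 (text read).
* [Ran1980] Z. Ran, Cycles on Fermat hypersurfaces, Compositio Math. 42 (1980), §1 Prop. 1.7 (iii)
  (p. 125) (text read, numdam).
-/

noncomputable section

open CategoryTheory AlgebraicGeometry MvPolynomial

namespace Literature.AlgebraicGeometry.HodgeTheory

open Literature.AlgebraicGeometry.Motives Literature.AlgebraicTopology.SingularHomology

variable {n m : ℕ}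

/-! ### `χ_{tα} = χ_αᵗ` -/

/-- **`χ_{tα} = χ_α ^ t`** for a unit `t ∈ (ℤ/m)ˣ` (exponent the representative `t.val ∈ [0, m-1]`):
`aᵢ^{⟨t αᵢ⟩} = aᵢ^{⟨t⟩⟨αᵢ⟩}` since `aᵢᵐ = 1`. [cite: Shioda1979PJA, §1 and §4] -/
theorem fermatCharacter_unitMul (t : (ZMod m)ˣ) (α : Fin (n + 2) → ZMod m) :
    fermatCharacter m (fun i ↦ (t : ZMod m) * α i) = fermatCharacter m α ^ (t : ZMod m).val := by
  ext a : 1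
  rw [MonoidHom.pow_apply, fermatCharacter_apply, fermatCharacter_apply, ← Finset.prod_pow]
  refine Finset.prod_congr rfl fun i _ ↦ ?_
  have hai : (a : Fin (n + 2) → ℂˣ) i ^ m = 1 := mem_fermatGroup_iff.mp a.2 i
  rw [ZMod.val_mul, ← pow_eq_pow_mod _ hai, pow_mul']

/-! ### The isotypic projectors `π_α` -/

variable (m) in
/-- **The isotypic projector `π_α = m^{-(n+2)} Σ_{a ∈ μₘⁿ⁺²} χ_α(a)⁻¹ g_a^*` onto `V(α) ⊆ Hᵏ(X_F(ℂ); ℂ)`**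
(`eigenProjector` of `DiagonalCharacterEigenspace` for `μₘⁿ⁺² ≤ diagonalStabilizer F`, `m ≥ 1`).
[cite: Shioda1979PJA, §4] -/
abbrev fermatProjector [NeZero m] (α : Fin (n + 2) → ZMod m) (k : ℕ) :
    Module.End ℂ (complexBetti (SmoothHypersurface.hypersurface (fermatPolynomial ℂ n m)) k) :=
  eigenProjector (fermatPolynomial ℂ n m) (fermatCharacter m α) k (fermatGroup_le_diagonalStabilizer m)

/-- `π_α c ∈ V(α)`. [cite: Shioda1979PJA, §4] -/
theorem fermatProjector_mem [NeZero m] (α : Fin (n + 2) → ZMod m) {k : ℕ}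
    (c : complexBetti (SmoothHypersurface.hypersurface (fermatPolynomial ℂ n m)) k) :
    fermatProjector m α k c ∈ fermatEigenspace m α k :=
  eigenProjector_mem _ _ c

/-- `π_α` is the identity on `V(α)`. [cite: Shioda1979PJA, §4] -/
theorem fermatProjector_apply_of_mem [NeZero m] {α : Fin (n + 2) → ZMod m} {k : ℕ}
    {c : complexBetti (SmoothHypersurface.hypersurface (fermatPolynomial ℂ n m)) k} (hc : c ∈ fermatEigenspace m α k) :
    fermatProjector m α k c = c :=
  eigenProjector_apply_of_mem _ _ hc

/-- `π_β` kills `V(α)` for `α ≠ β`. [cite: Shioda1979PJA, §4] -/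
theorem fermatProjector_apply_of_mem_of_ne [NeZero m] {α β : Fin (n + 2) → ZMod m} {k : ℕ}
    {c : complexBetti (SmoothHypersurface.hypersurface (fermatPolynomial ℂ n m)) k} (hc : c ∈ fermatEigenspace m α k)
    (hne : α ≠ β) : fermatProjector m β k c = 0 :=
  eigenProjector_apply_of_mem_of_ne _ _ hc fun h ↦ hne (fermatCharacter_injective h)

/-- **`Σ_α π_α c = c`**: every class is the sum of its eigencomponents (re-indexing
`sum_eigenProjector_apply` along `α ↦ χ_α`). [cite: Shioda1979PJA, §4] -/
theorem sum_fermatProjector [NeZero m] {k : ℕ}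
    (c : complexBetti (SmoothHypersurface.hypersurface (fermatPolynomial ℂ n m)) k) :
    ∑ α : Fin (n + 2) → ZMod m, fermatProjector m α k c = c := by
  classical
  calc ∑ α : Fin (n + 2) → ZMod m, fermatProjector m α k c
      = ∑ χ : fermatGroup n m →* ℂˣ, eigenProjector (fermatPolynomial ℂ n m) χ k (fermatGroup_le_diagonalStabilizer m) c :=
        Fintype.sum_bijective _ fermatCharacter_bijective _ _ fun _ ↦ rfl
    _ = c := sum_eigenProjector_apply (fermatPolynomial ℂ n m) (fermatGroup_le_diagonalStabilizer m) c

/-! ### The support of a rational class is stable under `(ℤ/m)ˣ` -/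

/-- **For a rational class `c` and a unit `t ∈ (ℤ/m)ˣ`: `π_α c = 0 ↔ π_{tα} c = 0`** — the set of
`α` with `π_α c ≠ 0` is a union of `(ℤ/m)ˣ`-orbits (`eigenProjector_eq_zero_iff_pow` with `s = ⟨t⟩`,
prime to `m` hence to `|μₘⁿ⁺²| = mⁿ⁺²`, and `χ_{tα} = χ_αˢ`). This is the mechanism behind "for all
`t ∈ (ℤ/m)ˣ`" in Shioda's `𝔅ⁿₘ` / Ran's Hodge characters.
[cite: Shioda1979PJA, §1 eq. (2) and §4] [cite: Ran1980, §1 Prop. 1.7 (iii)] -/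
theorem fermatProjector_eq_zero_iff_unitMul [NeZero m] {k : ℕ}
    {c : complexBetti (SmoothHypersurface.hypersurface (fermatPolynomial ℂ n m)) k} (hc : IsRationalClass c)
    (α : Fin (n + 2) → ZMod m) (t : (ZMod m)ˣ) :
    fermatProjector m α k c = 0 ↔ fermatProjector m (fun i ↦ (t : ZMod m) * α i) k c = 0 := by
  have hs : (t : ZMod m).val.Coprime (Fintype.card (fermatGroup n m)) := by
    rw [Fintype.card_eq_nat_card, card_fermatGroup]
    exact (ZMod.val_coe_unit_coprime t).pow_right _
  rw [fermatProjector, fermatProjector, fermatCharacter_unitMul]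
  exact eigenProjector_eq_zero_iff_pow _ _ _ k hc hs

/-- **`π_α c = 0 ↔ π_{-α} c = 0` for a rational class `c`** (the unit `t = -1`: complex conjugation
exchanges `V(α)` and `V(-α)`). [cite: Ran1980, §1 (1.7) and Prop. 1.7 (iii)] -/
theorem fermatProjector_eq_zero_iff_neg [NeZero m] {k : ℕ}
    {c : complexBetti (SmoothHypersurface.hypersurface (fermatPolynomial ℂ n m)) k} (hc : IsRationalClass c)
    (α : Fin (n + 2) → ZMod m) :
    fermatProjector m α k c = 0 ↔ fermatProjector m (-α) k c = 0 := by
  have h := fermatProjector_eq_zero_iff_unitMul hc α (-1)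
  simp only [Units.val_neg, Units.val_one, neg_mul, one_mul] at h
  exact h

/-- Non-vanishing form: the support `{α | π_α c ≠ 0}` of a rational class is `(ℤ/m)ˣ`-stable.
[cite: Shioda1979PJA, §1 eq. (2) and §4] -/
theorem fermatProjector_ne_zero_of_unitMul [NeZero m] {k : ℕ}
    {c : complexBetti (SmoothHypersurface.hypersurface (fermatPolynomial ℂ n m)) k} (hc : IsRationalClass c)
    {α : Fin (n + 2) → ZMod m} (hα : fermatProjector m α k c ≠ 0) (t : (ZMod m)ˣ) :
    fermatProjector m (fun i ↦ (t : ZMod m) * α i) k c ≠ 0 :=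
  fun h ↦ hα ((fermatProjector_eq_zero_iff_unitMul hc α t).mpr h)

end Literature.AlgebraicGeometry.HodgeTheory

end
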